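import Summits.QuantumFields.YangMills.Theorems.SoloBlindOddTorusSlabDecay
import Summits.QuantumFields.YangMills.Theorems.SoloBlindSpeciesSlab
import HarnessLib

/-!
# `HasLatticeMassGap` is equivalent to antipodal decay of the REFLECTION clauses
# (solo-QuantumFields-blind, rung D8, part 11)

`Summit.QuantumFields.YangMills.Theorems.SoloBlindLatticeGapReflected` (read-only conjunct
`YangMills`).  Part 6 reduced the clauses of the conjunct `HasLatticeMassGap r sch Δ` on the
time-zero spatial algebra to antipodal diagonal decay.  This part removes the restriction: write
`Θ A := A.timeReflect` (tree, `SpeciesTimeReflection`) and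
`c_{A,B}(n; S) := latticeConnectedCorr r.ρ β (2S+1) A B n`.  For a weak-coupling scheme and
`Δ ≥ 0`:

* `latticeGapClause_of_reflectedAntipodalDecay` — if the two REFLECTION clauses of `A` decay at
  the ANTIPODE, `c_{ΘA,A}(S; S), c_{A,ΘA}(S; S) ≤ C_A e^{-Δ a_k S}` eventually in `k` for all
  `S ≥ L_k`, and likewise for `B`, then the clause of `HasLatticeMassGap r sch Δ` for the pair
  `(A, B)` holds (every `n ≤ S`) — for ALL species `A, B`;
* `hasLatticeMassGap_iff_reflectedAntipodalDecay` — hence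
  `HasLatticeMassGap r sch Δ ↔ ∀ A, HasReflectedAntipodalDecay r sch Δ A`.

Mechanism (parts 8–10): every species lives in a finite time slab (part 10); on the statement's own odd
tori the OS pairing of slab observables is a positive-semidefinite Hankel kernel along odd
separations by link reflection positivity (`β ≥ 0`, any compact `G`); log-convexity interpolates
between the trivial bound at small separation and the hypothesis at the antipode, and the OS
Schwarz inequality transfers the diagonal rate to every pair.  No decay is produced: the file
types WHERE a proof of the lattice mass gap must deliver it.
[folklore: Seiler LNP 159 Ch. 2; Osterwalder–Seiler 1978 §2]
-/

open MeasureTheory Filter Topology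
open Literature.MathematicalPhysics.QuantumFieldTheory Literature.MathematicalPhysics.QuantumLattice

noncomputable section

namespace Summit.QuantumFields.YangMills.Theorems.SoloBlind

variable {G : Type} [Group G] [TopologicalSpace G] [IsTopologicalGroup G] [CompactSpace G]
  [MeasurableSpace G] [BorelSpace G]

/-! ### Arithmetic of the constants -/

/-- Low index: `x ≤ q ≤ (max C 0 + q)(E t)` when `q ≥ 0`, `E t ≥ 1`. -/
private theorem le_K_low {C q E t x : ℝ} (hq : 0 ≤ q) (hx : x ≤ q) (hEt : 1 ≤ E * t) :
    x ≤ (max C 0 + q) * E * t := by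
  have h0 : 0 ≤ max C 0 + q := add_nonneg (le_max_right _ _) hq
  calc x ≤ (max C 0 + q) * 1 := by linarith [le_max_right C 0]
    _ ≤ (max C 0 + q) * (E * t) := mul_le_mul_of_nonneg_left hEt h0
    _ = (max C 0 + q) * E * t := by ring

/-- Antipode: `x ≤ C p ≤ (max C 0 + q) E p` when `q ≥ 0`, `E ≥ 1`, `p ≥ 0`. -/
private theorem le_K_mid {C q E p x : ℝ} (hq : 0 ≤ q) (hE : 1 ≤ E) (hp : 0 ≤ p)
    (hx : x ≤ C * p) : x ≤ (max C 0 + q) * E * p := by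
  have h0 : 0 ≤ max C 0 + q := add_nonneg (le_max_right _ _) hq
  calc x ≤ C * p := hx
    _ ≤ (max C 0 + q) * 1 * p := by
        apply mul_le_mul_of_nonneg_right _ hp; linarith [le_max_left C 0]
    _ ≤ (max C 0 + q) * E * p :=
        mul_le_mul_of_nonneg_right (mul_le_mul_of_nonneg_left hE h0) hp

/-- Past the antipode: `x ≤ C p ≤ (max C 0 + q) E (p θ)` when `q ≥ 0`, `E θ ≥ 1`, `p ≥ 0`. -/
private theorem le_K_succ {C q E p θ x : ℝ} (hq : 0 ≤ q) (hEθ : 1 ≤ E * θ) (hp : 0 ≤ p)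
    (hx : x ≤ C * p) : x ≤ (max C 0 + q) * E * (p * θ) := by
  have h0 : 0 ≤ max C 0 + q := add_nonneg (le_max_right _ _) hq
  calc x ≤ C * p := hx
    _ ≤ (max C 0 + q) * 1 * p := by
        apply mul_le_mul_of_nonneg_right _ hp; linarith [le_max_left C 0]
    _ ≤ (max C 0 + q) * (E * θ) * p :=
        mul_le_mul_of_nonneg_right (mul_le_mul_of_nonneg_left hEθ h0) hp
    _ = (max C 0 + q) * E * (p * θ) := by ring

/-! ### The scheme-level reduction -/

/-- **Antipodal decay of the two reflection clauses of `A`** along the scheme, at rate `Δ` in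
physical units: `c_{ΘA,A}(S; S), c_{A,ΘA}(S; S) ≤ C e^{-Δ a_k S}` eventually in `k`, for all
`S ≥ L_k` — two of the clauses of `HasLatticeMassGap r sch Δ`, read at the antipode only. -/
def HasReflectedAntipodalDecay (r : LatticeRep G) (sch : SpeciesScheme (YMSpecies G)) (Δ : ℝ)
    (A : YMSpecies G) : Prop :=
  ∃ C : ℝ, ∀ᶠ k in atTop, ∀ S : ℕ, sch.L k ≤ S →
    latticeConnectedCorr r.ρ (sch.β k) (2 * S + 1) A.timeReflect.F A.F S ≤
        C * Real.exp (-(Δ * (sch.a k * S))) ∧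
      latticeConnectedCorr r.ρ (sch.β k) (2 * S + 1) A.F A.timeReflect.F S ≤
        C * Real.exp (-(Δ * (sch.a k * S)))

/-- The lattice-gap conjunct contains reflected antipodal decay of every species. -/
theorem reflectedAntipodalDecay_of_hasLatticeMassGap (r : LatticeRep G)
    {sch : SpeciesScheme (YMSpecies G)} {Δ : ℝ} (h : HasLatticeMassGap r sch Δ) (A : YMSpecies G) :
    HasReflectedAntipodalDecay r sch Δ A := by
  obtain ⟨C₁, h₁⟩ := h A.timeReflect A
  obtain ⟨C₂, h₂⟩ := h A A.timeReflect
  refine ⟨max C₁ C₂, ?_⟩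
  filter_upwards [h₁, h₂] with k hk₁ hk₂
  intro S hS
  exact ⟨(le_abs_self _).trans ((hk₁ S hS S le_rfl).trans
      (mul_le_mul_of_nonneg_right (le_max_left _ _) (Real.exp_pos _).le)),
    (le_abs_self _).trans ((hk₂ S hS S le_rfl).trans
      (mul_le_mul_of_nonneg_right (le_max_right _ _) (Real.exp_pos _).le))⟩

omit [TopologicalSpace G] [IsTopologicalGroup G] [CompactSpace G] [BorelSpace G] in
/-- `L_k → ∞`: eventually `N₀ ≤ L_k` (from `a_k L_k → ∞` and `a_k → 0`). [folklore] -/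
theorem eventually_le_L (sch : SpeciesScheme (YMSpecies G)) (N₀ : ℕ) :
    ∀ᶠ k in atTop, N₀ ≤ sch.L k := by
  filter_upwards [sch.tendsto_L.eventually_ge_atTop (N₀ : ℝ), eventually_a_le_one sch] with k hk ha
  have hL0 : (0 : ℝ) ≤ sch.L k := Nat.cast_nonneg _
  have h : (N₀ : ℝ) ≤ sch.L k := hk.trans (by nlinarith [sch.a_pos k])
  exact_mod_cast h

/-- **Main theorem: the pair clause from antipodal decay of the reflection clauses.**  For ANY
species `A, B`, a weak-coupling scheme and `Δ ≥ 0`, `HasReflectedAntipodalDecay` of `A` and of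
`B` imply the clause of `HasLatticeMassGap r sch Δ` for `(A, B)`.
[this unit's; mechanism folklore (OS positivity on the statement's odd tori)] -/
theorem latticeGapClause_of_reflectedAntipodalDecay (r : LatticeRep G)
    {sch : SpeciesScheme (YMSpecies G)} (hw : sch.HasWeakCouplingLimit) {Δ : ℝ} (hΔ : 0 ≤ Δ)
    (A B : YMSpecies G) (hdA : HasReflectedAntipodalDecay r sch Δ A)
    (hdB : HasReflectedAntipodalDecay r sch Δ B) : LatticeGapClause r sch Δ A B := by
  obtain ⟨TA', TA, hA⟩ := exists_isSlabSupported A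
  obtain ⟨TB', TB, hB⟩ := exists_isSlabSupported B
  obtain ⟨CA, hCA⟩ := hdA
  obtain ⟨CB, hCB⟩ := hdB
  obtain ⟨a0, ha0⟩ := A.bounded
  obtain ⟨b0, hb0⟩ := B.bounded
  have ha0' : ∀ U, |A.timeReflect.F U| ≤ a0 := fun U => by simpa using ha0 (cfgReflect U)
  have hb0' : ∀ U, |B.timeReflect.F U| ≤ b0 := fun U => by simpa using hb0 (cfgReflect U)
  -- constants (`FA = Â_c∘Θ'` is a `[-T_A, T'_A]`-slab, `FB = B̂_c` a `[-T'_B, T_B]`-slab observable)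
  set KA : ℝ := (max CA 0 + 2 * (a0 * a0)) * Real.exp (Δ * (2 * TA + 1 : ℕ)) with hKA
  set KB : ℝ := (max CB 0 + 2 * (b0 * b0)) * Real.exp (Δ * (2 * TB' + 1 : ℕ)) with hKB
  have haa : 0 ≤ 2 * (a0 * a0) := mul_nonneg two_pos.le (mul_self_nonneg a0)
  have hbb : 0 ≤ 2 * (b0 * b0) := mul_nonneg two_pos.le (mul_self_nonneg b0)
  refine ⟨max (Real.sqrt (KA * KB)) (2 * (a0 * b0) * Real.exp (Δ * (2 * (TA + TB') + 2 : ℕ))),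
    ?_⟩
  filter_upwards [hCA, hCB, eventually_beta_nonneg hw,
    eventually_le_L sch (2 * (TA + TA' + TB + TB') + 2), eventually_a_le_one sch]
    with k hAk hBk hβk hLk hak
  intro S hS n hn
  have hS' : 2 * (TA + TA' + TB + TB') + 2 ≤ S := hLk.trans hS
  have hS1 : 1 ≤ S := by omega
  have hρ := r.continuous
  -- the ratio `θ = e^{-Δ a_k} ∈ [e^{-Δ}, 1]`
  set θ : ℝ := Real.exp (-(Δ * sch.a k)) with hθdef
  have hθ : 0 < θ := Real.exp_pos _
  have hθpow : ∀ j : ℕ, Real.exp (-(Δ * (sch.a k * j))) = θ ^ j := fun j => by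
    rw [hθdef, ← Real.exp_nat_mul]; ring_nf
  have hθS : 0 ≤ θ ^ S := pow_nonneg hθ.le _
  -- `1 ≤ e^{Δ N} θ^j` for `j ≤ N`, and `1 ≤ e^{Δ N}`
  have hlow : ∀ {j N₁ : ℕ}, j ≤ N₁ → 1 ≤ Real.exp (Δ * N₁) * θ ^ j := by
    intro j N₁ hj
    rw [← hθpow, ← Real.exp_add]
    apply Real.one_le_exp
    have : Δ * (sch.a k * j) ≤ Δ * N₁ := by
      apply mul_le_mul_of_nonneg_left _ hΔ
      calc sch.a k * (j : ℝ) ≤ 1 * j := by gcongr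
        _ ≤ N₁ := by rw [one_mul]; exact_mod_cast hj
    linarith
  have hE1 : ∀ N₁ : ℕ, (1 : ℝ) ≤ Real.exp (Δ * N₁) := fun N₁ =>
    Real.one_le_exp (mul_nonneg hΔ (Nat.cast_nonneg _))
  -- the centred torus observables
  set FA : GaugeConfig 4 (2 * S + 1) G → ℝ := fun U =>
    toTorusObservable (2 * S + 1) A.F U.negReflect -
      wilsonExpectation r.ρ (sch.β k) (toTorusObservable (2 * S + 1) A.F) with hFA
  set FB : GaugeConfig 4 (2 * S + 1) G → ℝ := fun U =>
    toTorusObservable (2 * S + 1) B.F U -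
      wilsonExpectation r.ρ (sch.β k) (toTorusObservable (2 * S + 1) B.F) with hFB
  have hAm : Measurable FA :=
    ((A.measurable.comp (measurable_torusLift (2 * S + 1))).comp
      WilsonSiteRP.measurable_negReflect).sub_const _
  have hBm : Measurable FB := (B.measurable.comp (measurable_torusLift (2 * S + 1))).sub_const _
  have hAb : ∃ C : ℝ, ∀ U, |FA U| ≤ C :=
    ⟨a0 + |wilsonExpectation r.ρ (sch.β k) (toTorusObservable (2 * S + 1) A.F)|, fun U =>
      (abs_sub _ _).trans (by gcongr; rw [toTorusObservable_apply]; exact ha0 _)⟩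
  have hBb : ∃ C : ℝ, ∀ U, |FB U| ≤ C :=
    ⟨b0 + |wilsonExpectation r.ρ (sch.β k) (toTorusObservable (2 * S + 1) B.F)|, fun U =>
      (abs_sub _ _).trans (by gcongr; rw [toTorusObservable_apply]; exact hb0 _)⟩
  have hAs : DependsOn FA (slabEdges TA TA') :=
    dependsOn_toTorusObservable_negReflect_slab (by omega) (by omega) hS1 A hA _
  have hBs : DependsOn FB (slabEdges TB' TB) :=
    dependsOn_toTorusObservable_slab (by omega) (by omega) B hB _
  -- the three endpoint bounds for `FA`: indices `2T_A + 1`, `S`, `S + 1`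
  have hloA : osPairingSeq r.ρ (sch.β k) FA FA (2 * TA + 1) ≤ KA * θ ^ (2 * TA + 1) := by
    have h := (le_abs_self _).trans (abs_latticeConnectedCorr_le r.ρ hρ (sch.β k) S A
      A.timeReflect ha0 ha0' (2 * TA + 1))
    rw [← osPairingSeq_centred_negReflect_eq r.ρ hρ] at h
    exact le_K_low haa h (hlow le_rfl)
  have hm0A : osPairingSeq r.ρ (sch.β k) FA FA S ≤ KA * θ ^ S := by
    have h := (hAk S hS).2
    rw [hθpow, ← osPairingSeq_centred_negReflect_eq r.ρ hρ] at h
    exact le_K_mid haa (hE1 _) hθS h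
  have hm1A : osPairingSeq r.ρ (sch.β k) FA FA (S + 1) ≤ KA * θ ^ (S + 1) := by
    have h := (hAk S hS).1
    rw [hθpow, ← osPairingSeq_centred_negReflect_succ_eq r.ρ hρ] at h
    have h1 := hlow (N₁ := 2 * TA + 1) (j := 1) (by omega)
    rw [pow_one] at h1
    rw [pow_succ]
    exact le_K_succ haa h1 hθS h
  -- the three endpoint bounds for `FB`: indices `2T'_B + 1`, `S`, `S + 1`
  have hloB : osPairingSeq r.ρ (sch.β k) FB FB (2 * TB' + 1) ≤ KB * θ ^ (2 * TB' + 1) := by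
    have h := (le_abs_self _).trans (abs_latticeConnectedCorr_le r.ρ hρ (sch.β k) S
      B.timeReflect B hb0' hb0 (2 * TB' + 1))
    rw [← osPairingSeq_centred_eq r.ρ hρ] at h
    exact le_K_low hbb h (hlow le_rfl)
  have hm0B : osPairingSeq r.ρ (sch.β k) FB FB S ≤ KB * θ ^ S := by
    have h := (hBk S hS).1
    rw [hθpow, ← osPairingSeq_centred_eq r.ρ hρ] at h
    exact le_K_mid hbb (hE1 _) hθS h
  have hm1B : osPairingSeq r.ρ (sch.β k) FB FB (S + 1) ≤ KB * θ ^ (S + 1) := by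
    have h := (hBk S hS).2
    rw [hθpow, ← osPairingSeq_centred_succ_eq r.ρ hρ] at h
    have h1 := hlow (N₁ := 2 * TB' + 1) (j := 1) (by omega)
    rw [pow_one] at h1
    rw [pow_succ]
    exact le_K_succ hbb h1 hθS h
  -- all odd-index diagonal bounds (part 9)
  have hoddA : ∀ j, Odd j → 2 * TA + 1 ≤ j → j ≤ S + 1 →
      osPairingSeq r.ρ (sch.β k) FA FA j ≤ KA * θ ^ j := fun j hj h1 h2 =>
    osPairingSeq_odd_le_of_endpoints r.ρ rfl hρ hβk hAm hAb hAs (by omega) (by omega) hθ hloA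
      hm0A hm1A hj h1 h2
  have hoddB : ∀ j, Odd j → 2 * TB' + 1 ≤ j → j ≤ S + 1 →
      osPairingSeq r.ρ (sch.β k) FB FB j ≤ KB * θ ^ j := fun j hj h1 h2 =>
    osPairingSeq_odd_le_of_endpoints r.ρ rfl hρ hβk hBm hBb hBs (by omega) (by omega) hθ hloB
      hm0B hm1B hj h1 h2
  -- conclude: OS Schwarz for `n ≥ 2T_A + 2, 2T'_B + 2`, the trivial bound below
  rw [hθpow]
  have hθn : 0 ≤ θ ^ n := pow_nonneg hθ.le _
  by_cases hnA : 2 * (TA + TB') + 2 ≤ n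
  · have hmix := osPairingSeq_mixed_abs_le r.ρ rfl hρ hβk hAm hAb hAs hBm hBb hBs (by omega)
      (by omega) hθ hoddA hoddB (n := n) (by omega) (by omega) hn
    rw [latticeConnectedCorr_eq_osPairingSeq r.ρ hρ]
    exact hmix.trans (mul_le_mul_of_nonneg_right (le_max_left _ _) hθn)
  · push Not at hnA
    have hsmall := abs_latticeConnectedCorr_le r.ρ hρ (sch.β k) S A B ha0 hb0 n
    have hab : 0 ≤ 2 * (a0 * b0) := (abs_nonneg _).trans hsmall
    have h1 := hlow (N₁ := 2 * (TA + TB') + 2) (j := n) (by omega)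
    calc |latticeConnectedCorr r.ρ (sch.β k) (2 * S + 1) A.F B.F n|
        ≤ 2 * (a0 * b0) := hsmall
      _ ≤ 2 * (a0 * b0) * (Real.exp (Δ * (2 * (TA + TB') + 2 : ℕ)) * θ ^ n) :=
          le_mul_of_one_le_right hab h1
      _ = 2 * (a0 * b0) * Real.exp (Δ * (2 * (TA + TB') + 2 : ℕ)) * θ ^ n := by ring
      _ ≤ max (Real.sqrt (KA * KB)) (2 * (a0 * b0) * Real.exp (Δ * (2 * (TA + TB') + 2 : ℕ))) *
            θ ^ n :=
          mul_le_mul_of_nonneg_right (le_max_right _ _) hθn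

/-- **`HasLatticeMassGap` is equivalent to antipodal decay of the reflection clauses**
(weak-coupling scheme, `Δ ≥ 0`, every compact `G`, every faithful unitary `r`): the lattice
mass-gap conjunct of the summit — uniform exponential decay of ALL connected pair correlators at
ALL separations `n ≤ S` on all tori `(2S+1)⁴`, `S ≥ L_k` — holds iff, for every species `A`, the
two correlators `⟨ΘA · A(· + S e₀)⟩_c`, `⟨A · ΘA(· + S e₀)⟩_c` at the single ANTIPODAL
separation `S` decay like `e^{-Δ a_k S}`. [this unit's] -/
theorem hasLatticeMassGap_iff_reflectedAntipodalDecay (r : LatticeRep G)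
    {sch : SpeciesScheme (YMSpecies G)} (hw : sch.HasWeakCouplingLimit) {Δ : ℝ} (hΔ : 0 ≤ Δ) :
    HasLatticeMassGap r sch Δ ↔ ∀ A : YMSpecies G, HasReflectedAntipodalDecay r sch Δ A :=
  ⟨fun h A => reflectedAntipodalDecay_of_hasLatticeMassGap r h A,
    fun h A B => latticeGapClause_of_reflectedAntipodalDecay r hw hΔ A B (h A) (h B)⟩

end Summit.QuantumFields.YangMills.Theorems.SoloBlind

end
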